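import Literature.AlgebraicGeometry.Resolution.BlowupSNC
import Summits.ResolutionOfSingularities.ResolutionOfSingularities.Theorems.RadicialJungCleanModelsSufficeGameDefs

/-!
# Route `RadicialJung`, crux `CleanModelsSuffice`, line `Sketch`: one round over the centre — labels of the new boundary

Helper for the registered stub `stub_gameRoundOver` (one round of the exceptionalisation game, at a point OVER
the centre) of the skeleton of `Summit.ResolutionOfSingularities.ResolutionOfSingularities.Theses.RadicialJung.CleanModelsSuffice`
(stmt-ResolutionOfSingularities-15883). At a point `x` of the blow-up `φ : V' → V` over `v ∈ Z`, the chart data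
`Dc : ChartData φ C x` built from the state's labelled regular system of parameters at `v`
(`exists_chartData_of_rsop'`) come with a labelled regular system `v'` of `𝒪_{V',x}` (`ChartData.exists_rsop`).
This file proves:

* `ChartData.toStalk_gen_self`, `ChartData.isUnit_toStalk_gen` — the centre generator `e_i = 1`; a chart
  generator off `Q` is a unit at `x`;
* `roundOver_map_coord` — the images of the old coordinates: `φ^*(u_{σ l}) = φ^*(c_l) · x_i · e_l` (centre
  coordinates), `φ^*(u_{σ' m}) = φ^*(c'_m) · w_m` (the others), for units `c, c'`;
* `roundOver_exists_lab` — the LABELS of the new boundary `E.map (strictTransformIdeal φ C) ++ [C·𝒪_{V'}]` at `x`: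
  an injective assignment of coordinates of `v'` generating the stalks (exceptional ↦ `x_i`; strict transform of
  an old divisor with non-centre coordinate `σ' m` ↦ `w_m`; with centre coordinate `σ j` ↦ `e_j`, `j` good), with
  the support criteria for the strict transforms.
-/

noncomputable section

set_option linter.dupNamespace false -- mandated namespace of this single-conjunct summit

open CategoryTheory AlgebraicGeometry TopologicalSpace IsLocalRing
open Literature.AlgebraicGeometry.Resolution Literature.AlgebraicGeometry.Motives

namespace Summit.ResolutionOfSingularities.ResolutionOfSingularities.Theorems.RadicialJung.CleanModelsSuffice

section Chart

variable {V V' : Scheme.{0}} {φ : V' ⟶ V} {C : V.IdealSheafData}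

local notation3 "φch[" Dc "]" => reesChartBase (ChartData.x Dc (ChartData.i Dc))
  (Ideal.mem_span_range_self (f := ChartData.x Dc) (x := ChartData.i Dc))

/-- Splitting a product over `Fin r` at an index where the factor is `1` and along a predicate. [folklore] -/
theorem prod_eq_prod_subtype_mul_prod_subtype_of_eq_one {M : Type*} [CommMonoid M] {r : ℕ} (i : Fin r)
    (P : Fin r → Prop) [DecidablePred P] (f : Fin r → M) (hi : f i = 1) :
    ∏ l, f l = (∏ l : {l // l ≠ i ∧ P l}, f l.1) * ∏ l : {l // l ≠ i ∧ ¬ P l}, f l.1 := by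
  classical
  rw [← Fintype.prod_subtype_mul_prod_subtype (p := fun l => l ≠ i) f]
  have h1 : ∏ l : {l // ¬ l ≠ i}, f l.1 = 1 := by
    refine Finset.prod_eq_one fun l _ => ?_
    have : l.1 = i := by simpa using l.2
    rw [this, hi]
  rw [h1, mul_one, ← Fintype.prod_subtype_mul_prod_subtype (p := fun l : {l // l ≠ i} => P l.1) (fun l => f l.1)]
  congr 1
  · exact Fintype.prod_equiv (Equiv.subtypeSubtypeEquivSubtypeInter (fun l => l ≠ i) P) _ _ (fun _ => rfl)
  · exact Fintype.prod_equiv (Equiv.subtypeSubtypeEquivSubtypeInter (fun l => l ≠ i) (fun l => ¬ P l)) _ _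
      (fun _ => rfl)

/-- **The radicand upstairs, factor by factor.** With chart data `Dc` at `x` built from the coordinates `u₀`
at `v = φ x` (`σ`/`σ'` the centre / non-centre coordinates, associated to the germs of the chart sections):
the stalk map sends a centre coordinate `u₀ (σ l)` to `(unit) · x_i · e_l` and a non-centre coordinate
`u₀ (σ' m)` to `(unit) · w_m`, the units being images of units of `𝒪_{V,v}`. [folklore] -/
theorem roundOver_map_coord {x : V'} (Dc : ChartData φ C x)
    {d : ℕ} (u₀ : Fin d → V.presheaf.stalk (φ x))
    (σ : Fin Dc.r → Fin d) (σ' : Fin Dc.a → Fin d)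
    (hassx : ∀ l, Associated (u₀ (σ l)) ((V.presheaf.germ Dc.U (φ x) Dc.hxU).hom (Dc.x l)))
    (hassw : ∀ m, Associated (u₀ (σ' m)) ((V.presheaf.germ Dc.U (φ x) Dc.hxU).hom (Dc.w m))) :
    (∀ l, ∃ c : (V.presheaf.stalk (φ x))ˣ, (φ.stalkMap x).hom (u₀ (σ l)) =
      (φ.stalkMap x).hom ↑c * Dc.toStalk (φch[Dc] (Dc.x Dc.i)) * Dc.toStalk (Dc.gen l)) ∧
    (∀ m, ∃ c : (V.presheaf.stalk (φ x))ˣ, (φ.stalkMap x).hom (u₀ (σ' m)) =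
      (φ.stalkMap x).hom ↑c * Dc.toStalk (φch[Dc] (Dc.w m))) := by
  letI := Dc.algB
  constructor
  · intro l
    obtain ⟨c, hc⟩ := hassx l
    refine ⟨c⁻¹, ?_⟩
    have hu : u₀ (σ l) = ↑c⁻¹ * (V.presheaf.germ Dc.U (φ x) Dc.hxU).hom (Dc.x l) :=
      (Units.eq_inv_mul_iff_mul_eq (b := c)).mpr (by rw [mul_comm]; exact hc)
    rw [hu, map_mul, mul_assoc]
    congr 1
    rw [Dc.toStalk_eq, Dc.toStalk_eq, ← map_mul, ← reesChartBase_apply_eq_mul_chartGen Dc.x Dc.i l,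
      Dc.algebraMap_reesChartBase]
  · intro m
    obtain ⟨c, hc⟩ := hassw m
    refine ⟨c⁻¹, ?_⟩
    have hu : u₀ (σ' m) = ↑c⁻¹ * (V.presheaf.germ Dc.U (φ x) Dc.hxU).hom (Dc.w m) :=
      (Units.eq_inv_mul_iff_mul_eq (b := c)).mpr (by rw [mul_comm]; exact hc)
    rw [hu, map_mul, Dc.toStalk_eq, Dc.algebraMap_reesChartBase]

/-- The centre generator `e_i` is `1`, so its image in the stalk is `1`. [folklore] -/
theorem ChartData.toStalk_gen_self {x : V'} (Dc : ChartData φ C x) : Dc.toStalk (Dc.gen Dc.i) = 1 := by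
  letI := Dc.algB
  have h1 : Dc.gen Dc.i = 1 := chartGen_self Dc.x Dc.i
  rw [h1, Dc.toStalk_eq, map_one]

/-- A chart generator off `Q` is a unit in the stalk. [folklore] -/
theorem ChartData.isUnit_toStalk_gen {x : V'} (Dc : ChartData φ C x) {j : Fin Dc.r} (hj : Dc.gen j ∉ Dc.Q) :
    IsUnit (Dc.toStalk (Dc.gen j)) :=
  IsLocalRing.notMem_maximalIdeal.mp fun h => hj ((Dc.chartGen_mem_Q_iff j).mpr h)


end Chart

/-! ## The labels of the new boundary at a point over the centre -/

section Labels

variable {p : ℕ} {V₀ : Scheme.{0}} [IsIntegral V₀] {L : Type} [Field L] [Algebra V₀.functionField L]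
  {V : Scheme.{0}} [IsIntegral V] {π : V ⟶ V₀} [IsDominant π] [IsLocallyNoetherian V]
  {V' : Scheme.{0}} [IsLocallyNoetherian V'] {φ : V' ⟶ V} {C : V.IdealSheafData}

local notation3 "φch[" Dc "]" => reesChartBase (ChartData.x Dc (ChartData.i Dc))
  (Ideal.mem_span_range_self (f := ChartData.x Dc) (x := ChartData.i Dc))

set_option maxHeartbeats 400000 in
/-- **Labels of the new boundary at a point over the centre.** With the chart data `Dc` at `x` built from
the state's labelled regular system at `v = φ x` (`σ`/`σ'` enumerate the centre / non-centre coordinates, the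
chart sections being associated to the coordinates), and the labelled regular system `v'` of `𝒪_{V',x}`
(`ChartData.exists_rsop`: positions `lab' none` = the centre generator, `lab' (inl m)` = the non-centre
coordinates, `lab' (inr j)` = the good chart generators), every member `D'` of the new boundary
`E.map strictTransformIdeal ++ [exceptional]` through `x` gets a coordinate of `v'` generating its stalk:
the exceptional divisor ↦ `lab' none`; the strict transform of an old `K` with NON-centre coordinate `σ' m`
↦ `lab' (inl m)`; with centre coordinate `σ j` ↦ `lab' (inr j)` (then `j` is good). Distinct members get
distinct coordinates. [folklore] -/
theorem roundOver_exists_lab (S : GameState p V₀ L V π) {x : V'}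
    (hxC : φ x ∈ C.support) (Dc : ChartData φ C x)
    (σ : Fin Dc.r → Fin (S.d (φ x))) (σ' : Fin Dc.a → Fin (S.d (φ x)))
    (hrσσ' : ∀ t, t ∈ Set.range σ ∨ t ∈ Set.range σ')
    (hassx : ∀ l, Associated (S.u (φ x) (σ l)) ((V.presheaf.germ Dc.U (φ x) Dc.hxU).hom (Dc.x l)))
    (hassw : ∀ m, Associated (S.u (φ x) (σ' m)) ((V.presheaf.germ Dc.U (φ x) Dc.hxU).hom (Dc.w m)))
    {d' : ℕ} (v' : Fin d' → V'.presheaf.stalk x) (hregx : IsRegularLocalRing (V'.presheaf.stalk x))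
    (hsf' : (maximalIdeal (V'.presheaf.stalk x)).spanFinrank = d')
    (hspan' : Ideal.span (Set.range v') = maximalIdeal (V'.presheaf.stalk x))
    (lab' : Option (Fin Dc.a ⊕ Dc.GoodGen) → Fin d') (hlab' : Function.Injective lab')
    (hv0 : v' (lab' none) = Dc.toStalk (φch[Dc] (Dc.x Dc.i)))
    (hvw : ∀ m : Fin Dc.a, v' (lab' (some (Sum.inl m))) = Dc.toStalk (φch[Dc] (Dc.w m)))
    (hve : ∀ j : Dc.GoodGen, v' (lab' (some (Sum.inr j))) = Dc.toStalk (Dc.gen j.1)) :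
    ∃ lab : {D' : V'.IdealSheafData //
        D' ∈ S.E.map (strictTransformIdeal φ C) ++ [C.comap φ] ∧ x ∈ D'.support} → Fin d',
      Function.Injective lab ∧ (∀ D', stalkIdeal D'.1 x = Ideal.span {v' (lab D')}) ∧
      (∀ D', D'.1 = C.comap φ → lab D' = lab' none) ∧
      (∀ D' (K : {K : V.IdealSheafData // K ∈ S.E ∧ φ x ∈ K.support}) (m : Fin Dc.a),
        strictTransformIdeal φ C K.1 = D'.1 → S.lab (φ x) K = σ' m → lab D' = lab' (some (Sum.inl m))) ∧
      (∀ D' (K : {K : V.IdealSheafData // K ∈ S.E ∧ φ x ∈ K.support}) (j : Fin Dc.r),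
        strictTransformIdeal φ C K.1 = D'.1 → S.lab (φ x) K = σ j →
          ∃ hj : j ≠ Dc.i ∧ Dc.gen j ∈ Dc.Q, lab D' = lab' (some (Sum.inr ⟨j, hj⟩))) ∧
      (∀ (K : {K : V.IdealSheafData // K ∈ S.E ∧ φ x ∈ K.support}) (m : Fin Dc.a),
        S.lab (φ x) K = σ' m → x ∈ (strictTransformIdeal φ C K.1).support) ∧
      (∀ (K : {K : V.IdealSheafData // K ∈ S.E ∧ φ x ∈ K.support}) (j : Fin Dc.r),
        S.lab (φ x) K = σ j → (x ∈ (strictTransformIdeal φ C K.1).support ↔ j ≠ Dc.i ∧ Dc.gen j ∈ Dc.Q)) := by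
  classical
  haveI : IsRegularLocalRing (V.presheaf.stalk (φ x)) := S.isRegular (φ x)
  -- stalks of the old divisors through `v` in terms of the chart sections
  have hKx : ∀ (K : {K : V.IdealSheafData // K ∈ S.E ∧ φ x ∈ K.support}) (j : Fin Dc.r),
      S.lab (φ x) K = σ j →
        stalkIdeal K.1 (φ x) = Ideal.span {(V.presheaf.germ Dc.U (φ x) Dc.hxU).hom (Dc.x j)} := by
    intro K j hj
    rw [S.stalkIdeal_lab (φ x) K, hj]
    exact Ideal.span_singleton_eq_span_singleton.mpr (hassx j)
  have hKw : ∀ (K : {K : V.IdealSheafData // K ∈ S.E ∧ φ x ∈ K.support}) (m : Fin Dc.a),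
      S.lab (φ x) K = σ' m →
        stalkIdeal K.1 (φ x) = Ideal.span {(V.presheaf.germ Dc.U (φ x) Dc.hxU).hom (Dc.w m)} := by
    intro K m hm
    rw [S.stalkIdeal_lab (φ x) K, hm]
    exact Ideal.span_singleton_eq_span_singleton.mpr (hassw m)
  -- the stalks upstairs
  have hstx : ∀ (K : {K : V.IdealSheafData // K ∈ S.E ∧ φ x ∈ K.support}) (j : Fin Dc.r),
      S.lab (φ x) K = σ j → j ≠ Dc.i →
        stalkIdeal (strictTransformIdeal φ C K.1) x = Ideal.span {Dc.toStalk (Dc.gen j)} :=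
    fun K j hj hji => Dc.stalkIdeal_strictTransform_x hxC K.1 hji (hKx K j hj)
  have hstx_self : ∀ (K : {K : V.IdealSheafData // K ∈ S.E ∧ φ x ∈ K.support}),
      S.lab (φ x) K = σ Dc.i → stalkIdeal (strictTransformIdeal φ C K.1) x = ⊤ :=
    fun K hj => Dc.stalkIdeal_strictTransform_x_self hxC K.1 (hKx K Dc.i hj)
  have hstw : ∀ (K : {K : V.IdealSheafData // K ∈ S.E ∧ φ x ∈ K.support}) (m : Fin Dc.a),
      S.lab (φ x) K = σ' m →
        stalkIdeal (strictTransformIdeal φ C K.1) x = Ideal.span {Dc.toStalk (φch[Dc] (Dc.w m))} :=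
    fun K m hm => Dc.stalkIdeal_strictTransform_w hxC K.1 m (hKw K m hm)
  -- every member of `v'` lies in the maximal ideal
  have hv'mem : ∀ i, v' i ∈ maximalIdeal (V'.presheaf.stalk x) := fun i =>
    hspan' ▸ Ideal.subset_span ⟨i, rfl⟩
  letI := Dc.algB
  haveI := Dc.isLocalization_B
  -- support criteria upstairs
  have hsupp_w : ∀ (K : {K : V.IdealSheafData // K ∈ S.E ∧ φ x ∈ K.support}) (m : Fin Dc.a),
      S.lab (φ x) K = σ' m → x ∈ (strictTransformIdeal φ C K.1).support := by
    intro K m hm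
    rw [mem_support_iff_stalkIdeal_le, hstw K m hm, Ideal.span_le, Set.singleton_subset_iff, ← hvw m]
    exact hv'mem _
  have hsupp_x : ∀ (K : {K : V.IdealSheafData // K ∈ S.E ∧ φ x ∈ K.support}) (j : Fin Dc.r),
      S.lab (φ x) K = σ j →
        (x ∈ (strictTransformIdeal φ C K.1).support ↔ j ≠ Dc.i ∧ Dc.gen j ∈ Dc.Q) := by
    intro K j hj
    constructor
    · intro hxK
      have hle := (mem_support_iff_stalkIdeal_le _ _).mp hxK
      have hji : j ≠ Dc.i := by
        rintro rfl
        rw [hstx_self K hj, top_le_iff] at hle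
        exact (maximalIdeal.isMaximal _).ne_top hle
      refine ⟨hji, ?_⟩
      rw [hstx K j hj hji, Ideal.span_le, Set.singleton_subset_iff] at hle
      exact (Dc.chartGen_mem_Q_iff j).mpr hle
    · rintro ⟨hji, hjQ⟩
      rw [mem_support_iff_stalkIdeal_le, hstx K j hj hji, Ideal.span_le, Set.singleton_subset_iff]
      exact (Dc.chartGen_mem_Q_iff j).mp hjQ
  -- the position of each member of the new boundary through `x`
  have hpos : ∀ D' : {D' : V'.IdealSheafData //
      D' ∈ S.E.map (strictTransformIdeal φ C) ++ [C.comap φ] ∧ x ∈ D'.support},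
      ∃ o : Option (Fin Dc.a ⊕ Dc.GoodGen),
        (D'.1 = C.comap φ ∧ o = none) ∨
        (∃ K : {K : V.IdealSheafData // K ∈ S.E ∧ φ x ∈ K.support},
          strictTransformIdeal φ C K.1 = D'.1 ∧
          ((∃ m, S.lab (φ x) K = σ' m ∧ o = some (Sum.inl m)) ∨
           (∃ g : Dc.GoodGen, S.lab (φ x) K = σ g.1 ∧ o = some (Sum.inr g)))) := by
    intro D'
    by_cases hE : D'.1 = C.comap φ
    · exact ⟨none, Or.inl ⟨hE, rfl⟩⟩
    obtain ⟨K, hK⟩ := exists_preimage_divisor D' hE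
    rcases hrσσ' (S.lab (φ x) K) with ⟨j, hj⟩ | ⟨m, hm⟩
    · have hxD : x ∈ (strictTransformIdeal φ C K.1).support := by rw [hK]; exact D'.2.2
      have hgood := (hsupp_x K j hj.symm).mp hxD
      exact ⟨some (Sum.inr ⟨j, hgood⟩), Or.inr ⟨K, hK, Or.inr ⟨⟨j, hgood⟩, hj.symm, rfl⟩⟩⟩
    · exact ⟨some (Sum.inl m), Or.inr ⟨K, hK, Or.inl ⟨m, hm.symm, rfl⟩⟩⟩
  choose pos hposspec using hpos
  -- `v'` is a regular system of parameters: distinct members are not associated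
  have hrsop' : IsRsopPart v' := by
    haveI := hregx
    simpa using isRsopPart_comp_of_rsop hsf' v' hspan' id Function.injective_id
  haveI : IsDomain (V'.presheaf.stalk x) := by
    haveI := hregx; exact Literature.AlgebraicGeometry.Resolution.isDomain_of_isRegularLocalRing _
  have hspan_ne : ∀ {o o' : Option (Fin Dc.a ⊕ Dc.GoodGen)},
      Ideal.span {v' (lab' o)} = Ideal.span {v' (lab' o')} → o = o' := by
    intro o o' h
    by_contra hne
    exact hrsop'.not_associated (fun h' => hne (hlab' h')) (Ideal.span_singleton_eq_span_singleton.mp h)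
  -- the stalk of the exceptional ideal, a proper ideal
  have hExc_st : stalkIdeal (C.comap φ) x = Ideal.span {v' (lab' none)} := by
    rw [hv0]; exact Dc.stalkIdeal_exceptional hxC
  have hExc_ne_top : stalkIdeal (C.comap φ) x ≠ ⊤ := by
    rw [hExc_st]
    exact fun h => (maximalIdeal.isMaximal _).ne_top
      (top_le_iff.mp (h ▸ (Ideal.span_le.mpr (Set.singleton_subset_iff.mpr (hv'mem _)))))
  -- the exceptional member is never a strict transform of a divisor through `v`
  have hExc_ne : ∀ (K : {K : V.IdealSheafData // K ∈ S.E ∧ φ x ∈ K.support}),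
      strictTransformIdeal φ C K.1 ≠ C.comap φ := by
    intro K hKE
    rcases hrσσ' (S.lab (φ x) K) with ⟨j, hj⟩ | ⟨m, hm⟩
    · by_cases hji : j = Dc.i
      · exact hExc_ne_top (hKE ▸ hstx_self K (hji ▸ hj.symm))
      by_cases hjQ : Dc.gen j ∈ Dc.Q
      · have h1 := hstx K j hj.symm hji
        rw [hKE, hExc_st, ← hve ⟨j, hji, hjQ⟩] at h1
        exact absurd (hspan_ne h1) (by simp)
      · apply hExc_ne_top
        rw [← hKE, hstx K j hj.symm hji, Ideal.span_singleton_eq_top]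
        have hunit : Dc.toStalk (Dc.gen j) ∉ maximalIdeal (V'.presheaf.stalk x) :=
          fun h => hjQ ((Dc.chartGen_mem_Q_iff j).mpr h)
        exact (IsLocalRing.notMem_maximalIdeal.mp hunit)
    · have h1 := hstw K m hm.symm
      rw [hKE, hExc_st, ← hvw m] at h1
      exact absurd (hspan_ne h1) (by simp)
  -- strict transforms of distinct divisors through `v` are distinct (compare their coordinates at `v`)
  -- the label map
  refine ⟨fun D' => lab' (pos D'), ?_, ?_, ?_, ?_, ?_, hsupp_w, hsupp_x⟩
  · -- injective
    intro D₁ D₂ h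
    have ho : pos D₁ = pos D₂ := hlab' h
    apply Subtype.ext
    rcases hposspec D₁ with ⟨hE₁, ho₁⟩ | ⟨K₁, hK₁, hc₁⟩ <;>
      rcases hposspec D₂ with ⟨hE₂, ho₂⟩ | ⟨K₂, hK₂, hc₂⟩
    · rw [hE₁, hE₂]
    · exfalso
      rcases hc₂ with ⟨m, -, hm⟩ | ⟨g, -, hm⟩ <;> rw [ho, hm] at ho₁ <;> exact absurd ho₁ (by simp)
    · exfalso
      rcases hc₁ with ⟨m, -, hm⟩ | ⟨g, -, hm⟩ <;> rw [← ho, hm] at ho₂ <;> exact absurd ho₂ (by simp)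
    · -- both strict transforms: same position ⇒ same coordinate at `v` ⇒ same `K`
      have hlabK : S.lab (φ x) K₁ = S.lab (φ x) K₂ := by
        rcases hc₁ with ⟨m₁, hl₁, hm₁⟩ | ⟨g₁, hl₁, hm₁⟩ <;>
          rcases hc₂ with ⟨m₂, hl₂, hm₂⟩ | ⟨g₂, hl₂, hm₂⟩ <;>
          rw [hm₁, hm₂] at ho <;> simp only [Option.some.injEq, Sum.inl.injEq, Sum.inr.injEq,
            reduceCtorEq] at ho <;> rw [hl₁, hl₂, ho]
      have hK : K₁ = K₂ := S.lab_injective (φ x) hlabK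
      rw [← hK₁, ← hK₂, hK]
  · -- stalk ideals
    intro D'
    dsimp only
    rcases hposspec D' with ⟨hE, ho⟩ | ⟨K, hK, hc⟩
    · rw [hE, ho]; exact hExc_st
    · rcases hc with ⟨m, hl, hm⟩ | ⟨g, hl, hm⟩
      · rw [← hK, hm, hvw m]; exact hstw K m hl
      · rw [← hK, hm, hve g]; exact hstx K g.1 hl g.2.1
  · -- the exceptional member
    intro D' hE
    dsimp only
    rcases hposspec D' with ⟨-, ho⟩ | ⟨K, hK, -⟩
    · rw [ho]
    · exact absurd (hK.trans hE) (hExc_ne K)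
  · -- strict transform with non-centre coordinate
    intro D' K m hK hl
    dsimp only
    rcases hposspec D' with ⟨hE, -⟩ | ⟨K', hK', hc⟩
    · exact absurd (hK.trans hE) (hExc_ne K)
    · -- compare the stalks of `sT K' = D' = sT K` at `x`
      have hst : stalkIdeal D'.1 x = Ideal.span {v' (lab' (some (Sum.inl m)))} := by
        rw [← hK, hvw m]; exact hstw K m hl
      rcases hc with ⟨m', hl', hm'⟩ | ⟨g, hl', hm'⟩
      · have hst' : stalkIdeal D'.1 x = Ideal.span {v' (lab' (some (Sum.inl m')))} := by
          rw [← hK', hvw m']; exact hstw K' m' hl'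
        rw [hm']; exact congrArg lab' (hspan_ne (hst'.symm.trans hst))
      · have hst' : stalkIdeal D'.1 x = Ideal.span {v' (lab' (some (Sum.inr g)))} := by
          rw [← hK', hve g]; exact hstx K' g.1 hl' g.2.1
        exact absurd (hspan_ne (hst'.symm.trans hst)) (by simp)
  · -- strict transform with centre coordinate
    intro D' K j hK hl
    dsimp only
    have hxD : x ∈ (strictTransformIdeal φ C K.1).support := by rw [hK]; exact D'.2.2
    have hgood : j ≠ Dc.i ∧ Dc.gen j ∈ Dc.Q := (hsupp_x K j hl).mp hxD
    refine ⟨hgood, ?_⟩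
    rcases hposspec D' with ⟨hE, -⟩ | ⟨K', hK', hc⟩
    · exact absurd (hK.trans hE) (hExc_ne K)
    · set g₀ : Dc.GoodGen := ⟨j, hgood⟩ with hg₀
      have hst : stalkIdeal D'.1 x = Ideal.span {v' (lab' (some (Sum.inr g₀)))} := by
        rw [← hK, hve g₀]; exact hstx K j hl hgood.1
      rcases hc with ⟨m', hl', hm'⟩ | ⟨g', hl', hm'⟩
      · have hst' : stalkIdeal D'.1 x = Ideal.span {v' (lab' (some (Sum.inl m')))} := by
          rw [← hK', hvw m']; exact hstw K' m' hl'
        exact absurd (hspan_ne (hst'.symm.trans hst)) (by simp)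
      · have hst' : stalkIdeal D'.1 x = Ideal.span {v' (lab' (some (Sum.inr g')))} := by
          rw [← hK', hve g']; exact hstx K' g'.1 hl' g'.2.1
        rw [hm']
        exact congrArg lab' (hspan_ne (hst'.symm.trans hst))

end Labels

end Summit.ResolutionOfSingularities.ResolutionOfSingularities.Theorems.RadicialJung.CleanModelsSuffice

end
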